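import Literature.Probability.RandomPlanarGeometry.HexSAWSurfaceDensityFunction
import Mathlib.Topology.MetricSpace.Basic
import HarnessLib

/-!
# The FREE hook renewal for honeycomb wall bridges: `B^w_{n+8}(y) ≥ y·B^w_{n+6}(y) + h·y²·B^w_n(y)` and the second-order
# lower window `β(y)^8 ≥ y·β(y)^6 + h·y²` — the coefficient of `1/y` in `β(y)² − y` is at least the number `h` of minimal excursions

Topic `Literature/Probability/RandomPlanarGeometry` (lane «pcv-sawmu», a-idea-1 g27, door «HOOK-RENEWAL»; parent
`HexSAWSurfaceDensityFunction.lean` for the microcanonical counts `wbrN m v` of wall bridges of the honeycomb half-lattice in the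
brick-wall frame by surface visits, on top of `HexSAWSurfaceWallBridges.lean`: `wbr`, `visits`, `WB n y = Σ_{ω ∈ wbr n} y^{visits}`,
the junction concatenation `jcat` / `tailPiece` with `jcat_spec`, `WB_le_pow`, `WB_pos`, the growth rate `β(y) = wallRate y`).

THE MECHANISM.  A wall bridge can be EXTENDED in two ways that never produce the same walk: (U) append the two-step junction
`E → E + e₀ → E + 2e₀` (two more steps, one more visit); (H) append the junction and then a HOOK — a six-step wall bridge `υ` with
exactly one surface visit (its endpoint), e.g. `(0,0) → (1,0) → (1,−1) → (2,−1) → (3,−1) → (3,0) → (4,0)` (eight more steps, two more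
visits).  The images are disjoint because six steps before the end a (U)-extension sits ON the wall (at the end of the extended
bridge) while an (H)-extension sits at the hook's time `4`, which is OFF the wall (time `4` is even and is not a visit).  Both maps
are injective (`Zd.concatWalk_injective_pieces`, `tailPiece_injective`).  Hence, with `h := wbrN 6 1 = #(seeds 6)` (the number of
six-step wall bridges with one visit; `h = ws 4 2` in the density-function frame, `h ≥ 1` by the explicit hook of the companion
files, and `h = 1` by a finite enumeration NOT carried out here):
* §2 ★ THE FREE TWO-TERM SUPERADDITIVITY `wbrN (n+m) (a+1) + h_m · wbrN n a ≤ wbrN (n+m+2) (a+2)` for every seed length `m > 2`,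
  `h_m := wbrN m 1` (`wbrN_add_mul_le`; `m = 6`: `wbrN (n+6) (a+1) + h · wbrN n a ≤ wbrN (n+8) (a+2)`) — unlike the
  parent's block supermultiplicativity `wbrN n₁ v₁ · wbrN n₂ v₂ ≤ wbrN (n₁+2+n₂) (v₁+v₂+1)` the two terms have DIFFERENT length
  splits, so hooks may be interleaved with wall steps FREELY (compositions of the length into parts `2` and `8`), not only at the
  joints of blocks of a fixed length;
* §3 ★ THE PARTITION-FUNCTION RECURSION `y · B^w_{n+m}(y) + h_m · y² · B^w_n(y) ≤ B^w_{n+m+2}(y)` (`WB_seed_rec`, `y ≥ 0`);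
* §4 ★★ THE FREE-ENERGY INEQUALITY `y · β(y)^{2k} + h_{2k} · y² ≤ β(y)^{2k+2}` for every `y > 0`, `k ≥ 2` (`mul_pow_add_le_wallRate_pow`):
  every positive subsolution `x^{k+1} ≤ y x^k + h_{2k} y²` is a lower bound for `β(y)²` (`le_sq_wallRate_of_subsolution`: the
  recursion propagates `B^w_{2j} ≥ c x^j` from `k+1` consecutive values, and `B^w_{2j} ≤ (β²/y) β^{2j}`), and `β(y)²` itself is then
  not a strict subsolution (continuity); equivalently `β(y)² ≥ y + h_{2k} · y²/β(y)^{2k}` (`add_div_le_sq_wallRate`);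
* §5 ★★ THE HOOKS (`k = 3`): `y · β(y)^6 + h · y² ≤ β(y)^8`, i.e. `β(y)² ≥ y + h · y²/β(y)^6` (`mul_pow_six_add_le_wallRate_pow_eight`,
  `add_hook_div_le_sq_wallRate`); since `β(y)² = y + O(1/y)` (the companion windows), **`β(y)² − y ≥ (h − o(1))/y`** — under any
  upper window `β(y)² ≤ y + C/y` explicitly `β(y)² ≥ y + h·y⁵/(y² + C)³ ≥ y + h/y − 3hC/y³` (`sq_wallRate_window_lower`,
  `sq_wallRate_ge_sub`).

WHY THIS IS THE RIGHT CONSTANT (heuristic, not claimed).  Cutting a wall bridge at all its junctions writes it uniquely as a free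
product of PRIME pieces; the primes of lengths `2, 4, 6, 8` number `1, 0, h = 1, 1` (enumeration), so the renewal equation reads
`1 = y z + h y² z⁴ + y² z⁵ + …` at `z = 1/β(y)²`, i.e. `β(y)² = y + h/y + O(1/y²)`: the hook term alone fixes the coefficient of `1/y`.
This file proves the LOWER half of that statement with the exact constant `h`; the block form of the companion `HexSAWSurfaceSqrtStrict`
(`y⁴ + y² ≤ β(y)^8`, one hook per block of four slots) gives the coefficient `1/4`, and the upper windows in the lane give `6`
(`HexSAWSurfaceWallPotential`, `y ≥ 25`) and `729²` (`HexSAWSurfaceDensityEndRate`).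

HONEST LABEL.  LANE THEOREM, elementary (an injection and a four-term linear recursion); NEW IN WRITING (modest): the free two-term
renewal inequality for surface-weighted honeycomb wall bridges and the implicit second-order lower window `β^8 ≥ y β^6 + h y²` with the
renewal constant `h = wbrN 6 1`.  Sources of the ingredients: concatenation of surface bridges [HammersleyTorrieWhittington1982, §2],
the surface-visit weights of the honeycomb half-lattice [BeatonBousquetMelouDeGierDuminilCopinGuttmann2014, §3.1, Proposition 5
(arXiv v5 p. 9)], excursions and the end slope `z_d` of the density function [JansevanRensburg2000, §3.3.2, Lemma 3.20], the
supermultiplicative growth-rate calculus [MadrasSlade1993, §1.2, (1.2.15)–(1.2.17)].  NOT claimed: `h = 1`, `h ≥ 1` (imported by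
hypothesis where used: it is `one_le_ws_four_two` of the companion `HexSAWSurfaceDensitySlope`, or `dw` of `HexSAWSurfaceSqrtStrict`),
any UPPER bound, the full renewal (unique factorisation into primes), numerics.
-/

noncomputable section

open Finset Filter Function
open Literature.Probability.LatticeModels Literature.Probability.Percolation SimpleGraph
open Literature.Combinatorics.Enumerative
open _root_.Topology

namespace Literature.Probability.RandomPlanarGeometry.SAW.HexBW.Wall

open Literature.Probability.RandomPlanarGeometry.SAW.HV

variable {y : ℝ} {n m a : ℕ}

/-! ### §1 One-visit wall bridges (excursion seeds) are off the wall before their end -/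

/-- `visits` is monotone in the time. [cite: BeatonBousquetMelouDeGierDuminilCopinGuttmann2014, §3.1 (arXiv v5 p. 8: surface contacts)] -/
theorem visits_le_visits {t n : ℕ} (ω : ℕ → Site 2) (h : t ≤ n) : visits t ω ≤ visits n ω := by
  induction n, h using Nat.le_induction with
  | base => exact le_rfl
  | succ k _ ih => rw [visits_succ]; exact ih.trans (Nat.le_add_right _ _)

/-- A surface site at a positive even time is a visit. [cite: BeatonBousquetMelouDeGierDuminilCopinGuttmann2014, §3.1 (arXiv v5 p. 8: surface contacts)] -/
theorem one_le_visits_of_apply_eq_zero {t : ℕ} {ω : ℕ → Site 2} (ht : t % 2 = 0) (h0t : 0 < t) (hω : ω t 1 = 0) :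
    1 ≤ visits t ω := by
  obtain ⟨s, rfl⟩ : ∃ s, t = s + 1 := ⟨t - 1, by omega⟩
  rw [visits_succ, if_pos ⟨ht, hω⟩]
  exact Nat.le_add_left _ _

/-- **The seeds**: wall bridges of length `m` whose only surface visit is their endpoint (for `m = 6`: the hooks, the minimal
desorbed excursions). [cite: JansevanRensburg2000, §3.3.2, Lemma 3.20 (excursions and the end slope z_d)]
[cite: BeatonBousquetMelouDeGierDuminilCopinGuttmann2014, §3.1 (arXiv v5 p. 8: surface contacts)] -/
def seeds (m : ℕ) : Finset (ℕ → Site 2) := (wbr m).filter fun υ => visits m υ = 1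

/-- `#(seeds m) = wbrN m 1` (by definition). [cite: JansevanRensburg2000, §3.1.1, Assumptions 3.1 (the microcanonical counts)] -/
theorem card_seeds (m : ℕ) : #(seeds m) = wbrN m 1 := by rw [seeds, wbrN]

/-- In the density-function frame the hooks are counted by `ws 4 2 = wbrN 6 1` (three slots, density `2/4`).
[cite: JansevanRensburg2000, §3.1.1, Theorem 3.4] -/
theorem ws_four_two_eq : ws 4 2 = wbrN 6 1 := by
  rw [ws_of_ne_zero (by norm_num) 4]

/-- **A one-visit wall bridge is off the wall at every positive even time before its end.**
[cite: BeatonBousquetMelouDeGierDuminilCopinGuttmann2014, §3.1 (arXiv v5 p. 8: surface contacts)] -/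
theorem apply_ne_zero_of_visits_eq_one {υ : ℕ → Site 2} (hυ : υ ∈ wbr m) (hv : visits m υ = 1) {t : ℕ} (ht : t % 2 = 0)
    (h0t : 0 < t) (htm : t < m) : υ t 1 ≠ 0 := by
  obtain ⟨-, hm2, hend⟩ := mem_archs.1 (mem_wbr.1 hυ).1
  obtain ⟨s, rfl⟩ : ∃ s, m = s + 1 := ⟨m - 1, by omega⟩
  rw [visits_succ, if_pos ⟨hm2, hend⟩] at hv
  intro h0
  have h1 := one_le_visits_of_apply_eq_zero ht h0t h0
  have h2 := visits_le_visits υ (show t ≤ s by omega)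
  omega

/-! ### §2 The free two-term superadditivity (different length splits) -/

/-- The empty wall bridge. [cite: HammersleyTorrieWhittington1982, §2] -/
theorem straightWalk_zero_mem_wbr : Zd.straightWalk 2 0 ∈ wbr 0 := by
  simpa using straightWalk_mem_wbr 0

/-- (U)-extensions sit ON the wall at the old endpoint: `jcat m' ω υ m' = ω m'`, a surface site.
[cite: HammersleyTorrieWhittington1982, §2 (concatenation of surface bridges)] -/
theorem jcat_apply_self_one {m' : ℕ} {ω υ : ℕ → Site 2} (hω : ω ∈ wbr m') : jcat m' ω υ m' 1 = 0 := by
  have h : jcat m' ω υ m' = ω m' := Zd.concatWalk_apply_of_le _ _ le_rfl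
  rw [h]
  exact (mem_archs.1 (mem_wbr.1 hω).1).2.2

/-- (H)-extensions by a one-visit seed of length `m > 2` sit OFF the wall `m` steps after the old endpoint:
`jcat n ω υ (n+m) = ω n + tailPiece υ m` has height `υ (m-2) ≠ 0`. [cite: HammersleyTorrieWhittington1982, §2 (concatenation of surface bridges)] -/
theorem jcat_seed_apply_one {ω υ : ℕ → Site 2} (hω : ω ∈ wbr n) (hυ : υ ∈ wbr m) (hv : visits m υ = 1) (hm : 2 < m) :
    jcat n ω υ (n + m) 1 ≠ 0 := by
  obtain ⟨-, hm2, -⟩ := mem_archs.1 (mem_wbr.1 hυ).1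
  have hT := (tailPiece_spec hυ).1
  have hT0 : tailPiece υ 0 = 0 := (mem_saws_iff.1 hT).1
  have hυ0 : υ 0 = 0 := (mem_saws_iff.1 (hpw_subset (archs_subset (wbr_subset hυ)))).1
  have h : jcat n ω υ (n + m) = ω n + tailPiece υ m := Zd.concatWalk_apply_add _ _ hT0 m
  have h6 : tailPiece υ m 1 = υ (m - 2) 1 := by
    rw [show m = 2 + (m - 2) by omega, tailPiece_apply_add_one hυ0]
    congr 1; omega
  rw [h, Pi.add_apply, h6, (mem_archs.1 (mem_wbr.1 hω).1).2.2, zero_add]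
  exact apply_ne_zero_of_visits_eq_one hυ hv (by omega) (by omega) (by omega)

/-- ★ **THE FREE TWO-TERM SUPERADDITIVITY**: `wbrN (n+m) (a+1) + wbrN n a · wbrN m 1 ≤ wbrN (n+m+2) (a+2)` for every seed
length `m > 2` — extend a wall bridge of length `n+m` by the junction (U), or a wall bridge of length `n` by the junction and a
one-visit seed of length `m` (H); both maps are injective into the wall bridges of length `n+m+2` with `a+2` visits, and their
images are disjoint (`jcat_apply_self_one` vs `jcat_seed_apply_one`).  For `m = 6` the seeds are the hooks.
[cite: HammersleyTorrieWhittington1982, §2 (concatenation of surface bridges)] [cite: JansevanRensburg2000, §3.1.1, Assumptions 3.1(3), eqn (3.1)] -/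
theorem wbrN_add_mul_le (hm : 2 < m) (n a : ℕ) : wbrN (n + m) (a + 1) + wbrN n a * wbrN m 1 ≤ wbrN (n + m + 2) (a + 2) := by
  classical
  set triv : ℕ → Site 2 := Zd.straightWalk 2 0 with htriv
  have htm : triv ∈ wbr 0 := straightWalk_zero_mem_wbr
  set U := (wbr (n + m)).filter (fun ω => visits (n + m) ω = a + 1) with hU
  set H := ((wbr n).filter (fun ω => visits n ω = a)) ×ˢ seeds m with hH
  set T := (wbr (n + m + 2)).filter (fun ζ => visits (n + m + 2) ζ = a + 2) with hT
  set fU : (ℕ → Site 2) → (ℕ → Site 2) := fun ω => jcat (n + m) ω triv with hfU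
  set fH : (ℕ → Site 2) × (ℕ → Site 2) → (ℕ → Site 2) := fun q => jcat n q.1 q.2 with hfH
  -- images lie in T
  have hUT : U.image fU ⊆ T := by
    intro ζ hζ
    obtain ⟨ω, hω, rfl⟩ := Finset.mem_image.1 hζ
    obtain ⟨hωw, hωv⟩ := Finset.mem_filter.1 hω
    have sp := jcat_spec hωw htm
    rw [show n + m + (2 + 0) = n + m + 2 by omega, hωv, visits_zero] at sp
    exact Finset.mem_filter.2 ⟨sp.1, sp.2⟩
  have hHT : H.image fH ⊆ T := by
    intro ζ hζ
    obtain ⟨q, hq, rfl⟩ := Finset.mem_image.1 hζ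
    obtain ⟨hq1, hq2⟩ := Finset.mem_product.1 hq
    obtain ⟨hωw, hωv⟩ := Finset.mem_filter.1 hq1
    rw [seeds] at hq2
    obtain ⟨hυw, hυv⟩ := Finset.mem_filter.1 hq2
    have sp := jcat_spec hωw hυw
    rw [show n + (2 + m) = n + m + 2 by omega, hωv, hυv] at sp
    exact Finset.mem_filter.2 ⟨sp.1, sp.2⟩
  -- injectivity
  have hUinj : Set.InjOn fU ↑U := by
    intro ω hω ω' hω' h
    have hωs := hpw_subset (archs_subset (wbr_subset (Finset.mem_filter.1 (Finset.mem_coe.1 hω)).1))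
    have hω's := hpw_subset (archs_subset (wbr_subset (Finset.mem_filter.1 (Finset.mem_coe.1 hω')).1))
    exact (Zd.concatWalk_injective_pieces (saws_subset _ hωs) (saws_subset _ (tailPiece_spec htm).1)
      (saws_subset _ hω's) (saws_subset _ (tailPiece_spec htm).1) h).1
  have hHinj : Set.InjOn fH ↑H := by
    rintro ⟨ω, υ⟩ hq ⟨ω', υ'⟩ hq' h
    rw [Finset.mem_coe, hH, Finset.mem_product, seeds] at hq hq'
    have hωw := (Finset.mem_filter.1 hq.1).1
    have hω'w := (Finset.mem_filter.1 hq'.1).1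
    have hυw : υ ∈ wbr m := (Finset.mem_filter.1 hq.2).1
    have hυ'w : υ' ∈ wbr m := (Finset.mem_filter.1 hq'.2).1
    have hωs := hpw_subset (archs_subset (wbr_subset hωw))
    have hω's := hpw_subset (archs_subset (wbr_subset hω'w))
    have hυs := hpw_subset (archs_subset (wbr_subset hυw))
    have hυ's := hpw_subset (archs_subset (wbr_subset hυ'w))
    obtain ⟨h1, h2⟩ := Zd.concatWalk_injective_pieces (saws_subset _ hωs) (saws_subset _ (tailPiece_spec hυw).1)
      (saws_subset _ hω's) (saws_subset _ (tailPiece_spec hυ'w).1) h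
    have h3 := tailPiece_injective (mem_saws_iff.1 hυs).1 (mem_saws_iff.1 hυ's).1 h2
    simp only [Prod.mk.injEq]
    exact ⟨h1, h3⟩
  -- disjointness: the height `m` steps after the junction start
  have hdisj : Disjoint (U.image fU) (H.image fH) := by
    rw [Finset.disjoint_left]
    intro ζ hζU hζH
    obtain ⟨ω, hω, rfl⟩ := Finset.mem_image.1 hζU
    obtain ⟨q, hq, he⟩ := Finset.mem_image.1 hζH
    obtain ⟨hq1, hq2⟩ := Finset.mem_product.1 hq
    rw [seeds] at hq2
    have h0 : fU ω (n + m) 1 = 0 := jcat_apply_self_one (Finset.mem_filter.1 hω).1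
    have h1 : fH q (n + m) 1 ≠ 0 :=
      jcat_seed_apply_one (Finset.mem_filter.1 hq1).1 (Finset.mem_filter.1 hq2).1 (Finset.mem_filter.1 hq2).2 hm
    rw [he] at h1
    exact h1 h0
  -- count
  have hcU : #(U.image fU) = wbrN (n + m) (a + 1) := by rw [Finset.card_image_of_injOn hUinj, wbrN]
  have hcH : #(H.image fH) = wbrN n a * wbrN m 1 := by
    rw [Finset.card_image_of_injOn hHinj, hH, Finset.card_product, wbrN, card_seeds]
  calc wbrN (n + m) (a + 1) + wbrN n a * wbrN m 1 = #(U.image fU ∪ H.image fH) := by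
        rw [Finset.card_union_of_disjoint hdisj, hcU, hcH]
    _ ≤ #T := Finset.card_le_card (Finset.union_subset hUT hHT)
    _ = wbrN (n + m + 2) (a + 2) := by rw [wbrN]

/-- In the density-function frame (`m = 2k`): `ws (p+k) (i+1) + ws p i · ws (k+1) 2 ≤ ws (p+k+1) (i+2)` for `p, i ≥ 1`, `k ≥ 2`
(one more slot fully adsorbed, or `k+1` more slots carrying a one-visit seed).
[cite: JansevanRensburg2000, §3.1.1, Assumptions 3.1(3), eqn (3.1); §3.3.2, Lemma 3.20] -/
theorem ws_add_mul_le {p i k : ℕ} (hp : 1 ≤ p) (hi : 1 ≤ i) (hk : 2 ≤ k) :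
    ws (p + k) (i + 1) + ws p i * ws (k + 1) 2 ≤ ws (p + k + 1) (i + 2) := by
  rw [ws_of_ne_zero (by omega) (p + k), ws_of_ne_zero (by omega) p, ws_of_ne_zero (by omega) (k + 1),
    ws_of_ne_zero (by omega) (p + k + 1), show 2 * (p + k) - 2 = (2 * p - 2) + 2 * k by omega,
    show i + 1 - 1 = (i - 1) + 1 by omega, show 2 * (k + 1) - 2 = 2 * k by omega,
    show 2 * (p + k + 1) - 2 = (2 * p - 2) + 2 * k + 2 by omega, show i + 2 - 1 = (i - 1) + 2 by omega]
  exact wbrN_add_mul_le (by omega) (2 * p - 2) (i - 1)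

/-! ### §3 The partition-function recursion -/

/-- ★ **THE SEED RECURSION `y · B^w_{n+m}(y) + h_m · y² · B^w_n(y) ≤ B^w_{n+m+2}(y)`** (`h_m = wbrN m 1`, `m > 2`, `y ≥ 0`; for
`m = 6` the hook recursion `y B^w_{n+6} + h y² B^w_n ≤ B^w_{n+8}`): the weighted form of §2 — a (U)-extension carries one more
visit, an (H)-extension two more. [cite: HammersleyTorrieWhittington1982, §2 (concatenation of surface bridges)] [cite: MadrasSlade1993, §1.2, (1.2.15)] -/
theorem WB_seed_rec (hm : 2 < m) (n : ℕ) (hy : 0 ≤ y) :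
    y * WB (n + m) y + (wbrN m 1 : ℝ) * y ^ 2 * WB n y ≤ WB (n + m + 2) y := by
  classical
  set triv : ℕ → Site 2 := Zd.straightWalk 2 0 with htriv
  have htm : triv ∈ wbr 0 := straightWalk_zero_mem_wbr
  set fU : (ℕ → Site 2) → (ℕ → Site 2) := fun ω => jcat (n + m) ω triv with hfU
  set fH : (ℕ → Site 2) × (ℕ → Site 2) → (ℕ → Site 2) := fun q => jcat n q.1 q.2 with hfH
  set H := (wbr n) ×ˢ seeds m with hH
  have hUinj : Set.InjOn fU ↑(wbr (n + m)) := by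
    intro ω hω ω' hω' h
    have hωs := hpw_subset (archs_subset (wbr_subset (Finset.mem_coe.1 hω)))
    have hω's := hpw_subset (archs_subset (wbr_subset (Finset.mem_coe.1 hω')))
    exact (Zd.concatWalk_injective_pieces (saws_subset _ hωs) (saws_subset _ (tailPiece_spec htm).1)
      (saws_subset _ hω's) (saws_subset _ (tailPiece_spec htm).1) h).1
  have hHinj : Set.InjOn fH ↑H := by
    rintro ⟨ω, υ⟩ hq ⟨ω', υ'⟩ hq' h
    rw [Finset.mem_coe, hH, Finset.mem_product, seeds] at hq hq'
    have hυw : υ ∈ wbr m := (Finset.mem_filter.1 hq.2).1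
    have hυ'w : υ' ∈ wbr m := (Finset.mem_filter.1 hq'.2).1
    have hωs := hpw_subset (archs_subset (wbr_subset hq.1))
    have hω's := hpw_subset (archs_subset (wbr_subset hq'.1))
    have hυs := hpw_subset (archs_subset (wbr_subset hυw))
    have hυ's := hpw_subset (archs_subset (wbr_subset hυ'w))
    obtain ⟨h1, h2⟩ := Zd.concatWalk_injective_pieces (saws_subset _ hωs) (saws_subset _ (tailPiece_spec hυw).1)
      (saws_subset _ hω's) (saws_subset _ (tailPiece_spec hυ'w).1) h
    have h3 := tailPiece_injective (mem_saws_iff.1 hυs).1 (mem_saws_iff.1 hυ's).1 h2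
    simp only [Prod.mk.injEq]
    exact ⟨h1, h3⟩
  have hdisj : Disjoint ((wbr (n + m)).image fU) (H.image fH) := by
    rw [Finset.disjoint_left]
    intro ζ hζU hζH
    obtain ⟨ω, hω, rfl⟩ := Finset.mem_image.1 hζU
    obtain ⟨q, hq, he⟩ := Finset.mem_image.1 hζH
    obtain ⟨hq1, hq2⟩ := Finset.mem_product.1 hq
    rw [seeds] at hq2
    have h0 : fU ω (n + m) 1 = 0 := jcat_apply_self_one hω
    have h1 : fH q (n + m) 1 ≠ 0 :=
      jcat_seed_apply_one hq1 (Finset.mem_filter.1 hq2).1 (Finset.mem_filter.1 hq2).2 hm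
    rw [he] at h1
    exact h1 h0
  have hsub : (wbr (n + m)).image fU ∪ H.image fH ⊆ wbr (n + m + 2) := by
    refine Finset.union_subset (fun ζ hζ => ?_) (fun ζ hζ => ?_)
    · obtain ⟨ω, hω, rfl⟩ := Finset.mem_image.1 hζ
      have sp := (jcat_spec hω htm).1
      rwa [show n + m + (2 + 0) = n + m + 2 by omega] at sp
    · obtain ⟨q, hq, rfl⟩ := Finset.mem_image.1 hζ
      obtain ⟨hq1, hq2⟩ := Finset.mem_product.1 hq
      rw [seeds] at hq2
      have sp := (jcat_spec hq1 (Finset.mem_filter.1 hq2).1).1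
      rwa [show n + (2 + m) = n + m + 2 by omega] at sp
  -- the U-sum
  have hsumU : ∑ ζ ∈ (wbr (n + m)).image fU, y ^ visits (n + m + 2) ζ = y * WB (n + m) y := by
    rw [Finset.sum_image hUinj, WB, Finset.mul_sum]
    refine Finset.sum_congr rfl fun ω hω => ?_
    have sp := (jcat_spec hω htm).2
    rw [show n + m + (2 + 0) = n + m + 2 by omega, visits_zero, add_zero] at sp
    rw [hfU]; dsimp only
    rw [sp, pow_succ, mul_comm]
  -- the H-sum
  have hsumH : ∑ ζ ∈ H.image fH, y ^ visits (n + m + 2) ζ = (wbrN m 1 : ℝ) * y ^ 2 * WB n y := by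
    rw [Finset.sum_image hHinj, hH, Finset.sum_product, WB, Finset.mul_sum]
    refine Finset.sum_congr rfl fun ω hω => ?_
    have hterm : ∀ υ ∈ seeds m, y ^ visits (n + m + 2) (fH (ω, υ)) = y ^ 2 * y ^ visits n ω := by
      intro υ hυ
      rw [seeds] at hυ
      obtain ⟨hυw, hυv⟩ := Finset.mem_filter.1 hυ
      have sp := (jcat_spec hω hυw).2
      rw [show n + (2 + m) = n + m + 2 by omega, hυv] at sp
      rw [hfH]; dsimp only
      rw [sp, show visits n ω + 1 + 1 = visits n ω + 2 by ring, pow_add, mul_comm]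
    rw [Finset.sum_congr rfl hterm, Finset.sum_const, card_seeds, nsmul_eq_mul]
    ring
  calc y * WB (n + m) y + (wbrN m 1 : ℝ) * y ^ 2 * WB n y
      = ∑ ζ ∈ (wbr (n + m)).image fU ∪ H.image fH, y ^ visits (n + m + 2) ζ := by
        rw [Finset.sum_union hdisj, hsumU, hsumH]
    _ ≤ ∑ ζ ∈ wbr (n + m + 2), y ^ visits (n + m + 2) ζ :=
        Finset.sum_le_sum_of_subset_of_nonneg hsub fun _ _ _ => pow_nonneg hy _
    _ = WB (n + m + 2) y := by rw [WB]

/-! ### §4 The free-energy inequality `y · β(y)^{2k} + h_{2k} · y² ≤ β(y)^{2k+2}` -/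

/-- ★ **Every positive subsolution is a lower bound**: if `x > 0` and `x^{k+1} ≤ y x^k + h_{2k} y²` (`h_{2k} = wbrN (2k) 1`,
`k ≥ 2`), then `x ≤ β(y)²`.  (The recursion of §3 on even lengths, `E_{j+k+1} ≥ y E_{j+k} + h y² E_j` for `E_j = B^w_{2j}(y)`,
propagates `E_j ≥ c · x^j` from the first `k+1` values to all `j`, while `E_j ≤ (β²/y)·(β²)^j`.)
[cite: MadrasSlade1993, §1.2, (1.2.15)–(1.2.17)] [cite: HammersleyTorrieWhittington1982, §2] -/
theorem le_sq_wallRate_of_subsolution {k : ℕ} (hk : 2 ≤ k) (hy : 0 < y) {x : ℝ} (hx : 0 < x)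
    (hsub : x ^ (k + 1) ≤ y * x ^ k + (wbrN (2 * k) 1 : ℝ) * y ^ 2) : x ≤ wallRate y ^ 2 := by
  set h : ℝ := (wbrN (2 * k) 1 : ℝ) with hh
  have hh0 : 0 ≤ h := Nat.cast_nonneg _
  set E : ℕ → ℝ := fun j => WB (2 * j) y with hE
  have hEpos : ∀ j, 0 < E j := fun j => WB_pos hy j
  -- the recursion on even lengths
  have hrec : ∀ j, y * E (j + k) + h * y ^ 2 * E j ≤ E (j + k + 1) := by
    intro j
    have := WB_seed_rec (m := 2 * k) (by omega) (2 * j) hy.le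
    simp only [hE]
    rw [show 2 * (j + k) = 2 * j + 2 * k by ring, show 2 * (j + k + 1) = 2 * j + 2 * k + 2 by ring]
    exact this
  -- the constant c from the first k+1 values
  have hne : (Finset.range (k + 1)).Nonempty := ⟨0, by simp⟩
  set c : ℝ := (Finset.range (k + 1)).inf' hne (fun j => E j / x ^ j) with hc
  have hcpos : 0 < c := by
    rw [hc, Finset.lt_inf'_iff]
    exact fun j _ => div_pos (hEpos j) (pow_pos hx j)
  have hbase : ∀ j < k + 1, c * x ^ j ≤ E j := by
    intro j hj
    have hcj : c ≤ E j / x ^ j := Finset.inf'_le _ (Finset.mem_range.2 hj)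
    exact (le_div_iff₀ (pow_pos hx j)).1 hcj
  -- propagate
  have hall : ∀ j, c * x ^ j ≤ E j := by
    intro j
    induction j using Nat.strong_induction_on with
    | _ j ih =>
      rcases lt_or_ge j (k + 1) with hj | hj
      · exact hbase j hj
      · obtain ⟨i, rfl⟩ : ∃ i, j = i + k + 1 := ⟨j - (k + 1), by omega⟩
        have h3 := ih (i + k) (by omega)
        have h0 := ih i (by omega)
        calc c * x ^ (i + k + 1) = c * x ^ i * x ^ (k + 1) := by ring
          _ ≤ c * x ^ i * (y * x ^ k + h * y ^ 2) :=
              mul_le_mul_of_nonneg_left hsub (mul_nonneg hcpos.le (pow_nonneg hx.le _))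
          _ = y * (c * x ^ (i + k)) + h * y ^ 2 * (c * x ^ i) := by ring
          _ ≤ y * E (i + k) + h * y ^ 2 * E i := by
              have := mul_le_mul_of_nonneg_left h3 hy.le
              have := mul_le_mul_of_nonneg_left h0 (mul_nonneg hh0 (pow_nonneg hy.le 2))
              linarith
          _ ≤ E (i + k + 1) := hrec i
  -- upper bound and conclusion
  set B : ℝ := wallRate y ^ 2 with hB
  have hβ := wallRate_pos y
  have hBpos : 0 < B := pow_pos hβ 2
  have hup : ∀ j, E j ≤ B / y * B ^ j := by
    intro j
    have := WB_le_pow hy (2 * j)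
    simp only [hE]
    rw [hB, ← pow_mul]
    exact this
  by_contra hlt
  push Not at hlt
  have hratio : 1 < x / B := (one_lt_div hBpos).2 hlt
  have hbd : ∀ j, (x / B) ^ j ≤ B / (y * c) := by
    intro j
    have h1 : c * x ^ j ≤ B / y * B ^ j := (hall j).trans (hup j)
    have h1' : c * x ^ j * y ≤ B * B ^ j := by
      rw [div_mul_eq_mul_div, le_div_iff₀ hy] at h1
      exact h1
    rw [div_pow, div_le_div_iff₀ (pow_pos hBpos j) (mul_pos hy hcpos)]
    linarith
  obtain ⟨j, hj⟩ := ((tendsto_pow_atTop_atTop_of_one_lt hratio).eventually_gt_atTop (B / (y * c))).exists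
  exact absurd (hbd j) (not_le.2 hj)

/-- ★★ **THE FREE-ENERGY INEQUALITY `y · β(y)^{2k} + h_{2k} · y² ≤ β(y)^{2k+2}`** (`h_{2k} = wbrN (2k) 1`, `k ≥ 2`, every
`y > 0`): `β(y)²` is not a strict subsolution — if it were, a slightly larger `x` would still be one (continuity), contradicting
`le_sq_wallRate_of_subsolution`.  Equivalently `β(y)² ≥ y + h_{2k}·y²/β(y)^{2k}`: the one-visit seeds of length `2k`, interleaved
FREELY with wall steps, contribute `h_{2k} · y^{1-k}(1 + o(1))` to `β(y)² − y`.
[cite: JansevanRensburg2000, §3.3.2, Lemma 3.20] [cite: HammersleyTorrieWhittington1982, §2] [cite: MadrasSlade1993, §1.2, (1.2.17)] -/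
theorem mul_pow_add_le_wallRate_pow {k : ℕ} (hk : 2 ≤ k) (hy : 0 < y) :
    y * wallRate y ^ (2 * k) + (wbrN (2 * k) 1 : ℝ) * y ^ 2 ≤ wallRate y ^ (2 * k + 2) := by
  set B : ℝ := wallRate y ^ 2 with hB
  have hBpos : 0 < B := pow_pos (wallRate_pos y) 2
  have e6 : wallRate y ^ (2 * k) = B ^ k := by rw [hB, ← pow_mul]
  have e8 : wallRate y ^ (2 * k + 2) = B ^ (k + 1) := by rw [hB, ← pow_mul, show 2 * (k + 1) = 2 * k + 2 by ring]
  rw [e6, e8]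
  by_contra hlt
  push Not at hlt
  set g : ℝ → ℝ := fun x => y * x ^ k + (wbrN (2 * k) 1 : ℝ) * y ^ 2 - x ^ (k + 1) with hg
  have hgB : 0 < g B := by simp only [hg]; linarith
  have hcont : Continuous g := by simp only [hg]; fun_prop
  have hnhds : {x | 0 < g x} ∈ 𝓝 B := hcont.continuousAt.preimage_mem_nhds (Ioi_mem_nhds hgB)
  have hev : ∀ᶠ x in 𝓝[Set.Ioi B] B, 0 < g x := eventually_nhdsWithin_of_eventually_nhds hnhds
  obtain ⟨x, hxg, hxB⟩ := (hev.and self_mem_nhdsWithin).exists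
  have hxB' : B < x := hxB
  have hx : 0 < x := hBpos.trans hxB'
  have hsub : x ^ (k + 1) ≤ y * x ^ k + (wbrN (2 * k) 1 : ℝ) * y ^ 2 := by simp only [hg] at hxg; linarith
  exact absurd (le_sq_wallRate_of_subsolution hk hy hx hsub) (not_le.2 hxB')

/-- ★★ **`β(y)² ≥ y + h_{2k} · y²/β(y)^{2k}`** (`k ≥ 2`, `y > 0`). [cite: JansevanRensburg2000, §3.3.2, Lemma 3.20] [cite: HammersleyTorrieWhittington1982, §2] -/
theorem add_div_le_sq_wallRate {k : ℕ} (hk : 2 ≤ k) (hy : 0 < y) :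
    y + (wbrN (2 * k) 1 : ℝ) * y ^ 2 / wallRate y ^ (2 * k) ≤ wallRate y ^ 2 := by
  have hβ := wallRate_pos y
  have h6 : 0 < wallRate y ^ (2 * k) := pow_pos hβ _
  have key := mul_pow_add_le_wallRate_pow hk hy
  have e : y + (wbrN (2 * k) 1 : ℝ) * y ^ 2 / wallRate y ^ (2 * k) =
      (y * wallRate y ^ (2 * k) + (wbrN (2 * k) 1 : ℝ) * y ^ 2) / wallRate y ^ (2 * k) := by
    field_simp
  rw [e, div_le_iff₀ h6, show wallRate y ^ 2 * wallRate y ^ (2 * k) = wallRate y ^ (2 * k + 2) by ring]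
  exact key

/-! ### §5 The hooks (`k = 3`): the second-order lower window -/

/-- **The hook constant `h := wbrN 6 1`** as a real number: the number of six-step wall bridges with one visit (the hooks, e.g.
`(0,0) → (1,0) → (1,−1) → (2,−1) → (3,−1) → (3,0) → (4,0)`).  It is wrapped in a definition so that no tactic ever unfolds the
closed finite set behind it. [cite: JansevanRensburg2000, §3.3.2, Lemma 3.20 (excursions and the end slope z_d)] -/
def hookConst : ℝ := (wbrN 6 1 : ℝ)

/-- `hookConst = wbrN 6 1`. [cite: JansevanRensburg2000, §3.3.2, Lemma 3.20] -/
theorem hookConst_eq : hookConst = (wbrN 6 1 : ℝ) := rfl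

/-- `hookConst = ws 4 2` (density-function frame). [cite: JansevanRensburg2000, §3.1.1, Theorem 3.4] -/
theorem hookConst_eq_ws : hookConst = (ws 4 2 : ℝ) := by
  rw [hookConst_eq, ws_four_two_eq]

/-- `0 ≤ hookConst`. [cite: JansevanRensburg2000, §3.3.2, Lemma 3.20] -/
theorem hookConst_nonneg : 0 ≤ hookConst := by
  rw [hookConst_eq]; exact Nat.cast_nonneg _

/-- `1 ≤ hookConst` as soon as one hook is exhibited (`1 ≤ wbrN 6 1`, i.e. `1 ≤ ws 4 2`, supplied by the companion files).
[cite: JansevanRensburg2000, §3.3.2, Lemma 3.20] -/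
theorem one_le_hookConst (h1 : 1 ≤ wbrN 6 1) : 1 ≤ hookConst := by
  rw [hookConst_eq]; exact Nat.one_le_cast.2 h1

/-- ★★ **THE HOOK INEQUALITY `y · β(y)^6 + h · y² ≤ β(y)^8`** (`h = hookConst = wbrN 6 1 = ws 4 2`; every `y > 0`).
[cite: JansevanRensburg2000, §3.3.2, Lemma 3.20] [cite: HammersleyTorrieWhittington1982, §2] [cite: BeatonBousquetMelouDeGierDuminilCopinGuttmann2014, §3.1, Proposition 5 (arXiv v5 p. 9)] -/
theorem mul_pow_six_add_le_wallRate_pow_eight (hy : 0 < y) :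
    y * wallRate y ^ 6 + hookConst * y ^ 2 ≤ wallRate y ^ 8 := by
  have h := mul_pow_add_le_wallRate_pow (k := 3) (by norm_num) hy
  rw [show (2 * 3 : ℕ) = 6 by norm_num, show (6 + 2 : ℕ) = 8 by norm_num, ← hookConst_eq] at h
  exact h

/-- ★★ **`β(y)² ≥ y + h · y²/β(y)^6`** (`h = hookConst`, every `y > 0`): the second-order LOWER window with the renewal constant.
[cite: JansevanRensburg2000, §3.3.2, Lemma 3.20] [cite: HammersleyTorrieWhittington1982, §2] -/
theorem add_hook_div_le_sq_wallRate (hy : 0 < y) : y + hookConst * y ^ 2 / wallRate y ^ 6 ≤ wallRate y ^ 2 := by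
  have hβ := wallRate_pos y
  have h6 : 0 < wallRate y ^ 6 := pow_pos hβ 6
  have key := mul_pow_six_add_le_wallRate_pow_eight hy
  have e : y + hookConst * y ^ 2 / wallRate y ^ 6 = (y * wallRate y ^ 6 + hookConst * y ^ 2) / wallRate y ^ 6 := by
    field_simp
  rw [e, div_le_iff₀ h6, show wallRate y ^ 2 * wallRate y ^ 6 = wallRate y ^ 8 by ring]
  exact key

/-- With at least one hook: **`y · β(y)^6 + y² ≤ β(y)^8`**, i.e. `β(y)² ≥ y + y²/β(y)^6`.
[cite: JansevanRensburg2000, §3.3.2, Lemma 3.20] [cite: HammersleyTorrieWhittington1982, §2] -/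
theorem mul_pow_six_add_sq_le_wallRate_pow_eight (h1 : 1 ≤ hookConst) (hy : 0 < y) :
    y * wallRate y ^ 6 + y ^ 2 ≤ wallRate y ^ 8 := by
  have h := mul_pow_six_add_le_wallRate_pow_eight hy
  nlinarith [pow_nonneg hy.le 2]

/-- ★★ **THE SECOND-ORDER LOWER WINDOW UNDER AN UPPER WINDOW**: if `β(y)² ≤ y + C/y` (`C ≥ 0`, `y > 0`; the companion files give
`C = 6` for `y ≥ 25`), then `y + h · y⁵/(y² + C)³ ≤ β(y)²` (`h = hookConst`) — i.e. `β(y)² − y ≥ (h/y) · (1 + C/y²)⁻³`.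
[cite: JansevanRensburg2000, §3.3.2, Lemma 3.20] [cite: HammersleyTorrieWhittington1982, §2] -/
theorem sq_wallRate_window_lower (hy : 0 < y) {C : ℝ} (hC : 0 ≤ C) (hup : wallRate y ^ 2 ≤ y + C / y) :
    y + hookConst * y ^ 5 / (y ^ 2 + C) ^ 3 ≤ wallRate y ^ 2 := by
  have hβ := wallRate_pos y
  have hh0 := hookConst_nonneg
  have key := add_hook_div_le_sq_wallRate hy
  have hyc : 0 < y ^ 2 + C := by positivity
  have h6 : wallRate y ^ 6 ≤ (y ^ 2 + C) ^ 3 / y ^ 3 := by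
    have e : (y ^ 2 + C) ^ 3 / y ^ 3 = (y + C / y) ^ 3 := by
      field_simp
    rw [e, show wallRate y ^ 6 = (wallRate y ^ 2) ^ 3 by ring]
    exact pow_le_pow_left₀ (pow_nonneg hβ.le 2) hup 3
  have h6' : wallRate y ^ 6 * y ^ 3 ≤ (y ^ 2 + C) ^ 3 := by rwa [le_div_iff₀ (pow_pos hy 3)] at h6
  have hmono : hookConst * y ^ 5 / (y ^ 2 + C) ^ 3 ≤ hookConst * y ^ 2 / wallRate y ^ 6 := by
    rw [div_le_div_iff₀ (pow_pos hyc 3) (pow_pos hβ 6)]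
    have := mul_le_mul_of_nonneg_left h6' (by positivity : (0 : ℝ) ≤ hookConst * y ^ 2)
    have e : hookConst * y ^ 5 * wallRate y ^ 6 = hookConst * y ^ 2 * (wallRate y ^ 6 * y ^ 3) := by ring
    rw [e]
    exact this
  linarith

/-- The same window in polynomial form: **`β(y)² ≥ y + h/y − 3hC/y³`** (`h = hookConst`; from `(1 + C/y²)⁻³ ≥ 1 − 3C/y²`).
So `liminf_{y→∞} y·(β(y)² − y) ≥ h`: the renewal prediction `β(y)² = y + h/y + O(1/y²)` is sharp from below in the `1/y` term.
[cite: JansevanRensburg2000, §3.3.2, Lemma 3.20] [cite: HammersleyTorrieWhittington1982, §2] -/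
theorem sq_wallRate_ge_sub (hy : 0 < y) {C : ℝ} (hC : 0 ≤ C) (hup : wallRate y ^ 2 ≤ y + C / y) :
    y + hookConst / y - 3 * hookConst * C / y ^ 3 ≤ wallRate y ^ 2 := by
  have hh0 := hookConst_nonneg
  have key := sq_wallRate_window_lower hy hC hup
  have hyc : 0 < y ^ 2 + C := by positivity
  have hbern : 1 / y - 3 * C / y ^ 3 ≤ y ^ 5 / (y ^ 2 + C) ^ 3 := by
    have e : 1 / y - 3 * C / y ^ 3 = (y ^ 2 - 3 * C) / y ^ 3 := by
      rw [div_sub_div _ _ hy.ne' (pow_pos hy 3).ne', div_eq_div_iff (mul_pos hy (pow_pos hy 3)).ne' (pow_pos hy 3).ne']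
      ring
    rw [e, div_le_div_iff₀ (pow_pos hy 3) (pow_pos hyc 3)]
    nlinarith [pow_nonneg hC 2, pow_nonneg hC 3, pow_nonneg hy.le 2, mul_nonneg (pow_nonneg hC 2) (pow_nonneg hy.le 2),
      mul_nonneg hC (pow_nonneg hy.le 4), mul_nonneg (pow_nonneg hC 3) (pow_nonneg hy.le 2)]
  have := mul_le_mul_of_nonneg_left hbern hh0
  have e1 : hookConst * (1 / y - 3 * C / y ^ 3) = hookConst / y - 3 * hookConst * C / y ^ 3 := by ring
  have e2 : hookConst * (y ^ 5 / (y ^ 2 + C) ^ 3) = hookConst * y ^ 5 / (y ^ 2 + C) ^ 3 := by ring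
  linarith

end Literature.Probability.RandomPlanarGeometry.SAW.HexBW.Wall

end
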